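import Mathlib.Analysis.SpecialFunctions.SmoothTransition
import Mathlib.Analysis.Calculus.LocalExtr.Basic
import Mathlib.Analysis.Calculus.ContDiff.Deriv
import Mathlib.MeasureTheory.Integral.DominatedConvergence
import Mathlib.MeasureTheory.Integral.IntervalIntegral.Basic
import Mathlib.MeasureTheory.Integral.Bochner.Basic
import HarnessLib

/-!
# Smooth cutoffs on the line and truncation of quadratic forms

Topic `Literature/Analysis/Calculus` (namespace `Literature.Analysis.Calculus`). The standard
smooth plateau function `cutoff R` (`= 1` on `[-(R-1), R-1]`, `= 0` outside `(-R, R)`, values in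
`[0, 1]`, derivative bounded uniformly in `R`), built from Mathlib's `Real.smoothTransition`, and
the standard truncation lemma for quadratic forms of Schrödinger type: if `ψ, ψ' ∈ L²(ℝ)` (`ψ` of
class `C¹`), `W` is bounded and continuous, and `∫ (ψ'² + W ψ²) < E' ∫ ψ²`, then the compactly
supported truncations `φ_R = cutoff R · ψ` have `∫_{-R}^{R} (φ_R'² + (W - E') φ_R²) < 0` for all
large `R` (dominated convergence; the correction terms live where `cutoff R` is non-constant and
are dominated by a fixed multiple of `ψ² + ψ'²`). This is the density step "it suffices to test
the form on compactly supported functions" of the variational theory of Sturm–Liouville operators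
(Hartman, *Ordinary Differential Equations*, Ch. XI §6, admissible classes `A₁(a, b)`, `A₂(a, b)`
of functions vanishing at the endpoints). Everything is proved.

* `cutoff`, `cutoff_eq_one`, `cutoff_eq_zero`, `cutoff_nonneg`, `cutoff_le_one`, `contDiff_cutoff`,
  `hasDerivAt_cutoff`, `exists_bound_deriv_cutoff`, `deriv_cutoff_eq_zero_of_le`,
  `deriv_cutoff_eq_zero_of_lt`.
* `truncForm` — the integrand `(φ_R')² + (W - E') φ_R²` with `φ_R = cutoff R · ψ`;
  `exists_truncForm_integral_neg` — the truncation lemma.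

## References

* P. Hartman, *Ordinary Differential Equations*, Classics in Applied Mathematics 38 (SIAM 2002),
  Ch. XI §6 (the classes `A₁`, `A₂` and the functional `I(η; a, b)`, eq. (6.4)). Key `Hartman2002`.
-/

noncomputable section

open Set Filter MeasureTheory
open scoped Topology

namespace Literature.Analysis.Calculus

/-! ## The derivative of `Real.smoothTransition` -/

/-- `Real.smoothTransition` is differentiable. [folklore] -/
theorem differentiable_smoothTransition : Differentiable ℝ Real.smoothTransition :=
  (Real.smoothTransition.contDiff (n := 1)).differentiable (by simp)

/-- The derivative of `Real.smoothTransition` vanishes on `(-∞, 0]` (there the function has a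
local minimum, being `≥ 0 = smoothTransition t`). [folklore] -/
theorem deriv_smoothTransition_of_nonpos {t : ℝ} (ht : t ≤ 0) : deriv Real.smoothTransition t = 0 := by
  refine IsLocalMin.deriv_eq_zero ?_
  filter_upwards [] with s
  rw [Real.smoothTransition.zero_of_nonpos ht]
  exact Real.smoothTransition.nonneg s

/-- The derivative of `Real.smoothTransition` vanishes on `[1, ∞)` (local maximum). [folklore] -/
theorem deriv_smoothTransition_of_one_le {t : ℝ} (ht : 1 ≤ t) : deriv Real.smoothTransition t = 0 := by
  refine IsLocalMax.deriv_eq_zero ?_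
  filter_upwards [] with s
  rw [Real.smoothTransition.one_of_one_le ht]
  exact Real.smoothTransition.le_one s

/-- The derivative of `Real.smoothTransition` is bounded on `ℝ` (continuous, and zero off
`[0, 1]`). [folklore] -/
theorem exists_bound_deriv_smoothTransition : ∃ D : ℝ, 0 ≤ D ∧ ∀ t, |deriv Real.smoothTransition t| ≤ D := by
  have hc : Continuous (deriv Real.smoothTransition) :=
    (Real.smoothTransition.contDiff (n := 1)).continuous_deriv le_rfl
  obtain ⟨C, hC⟩ := isCompact_Icc.exists_bound_of_continuousOn (hc.continuousOn (s := Icc 0 1))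
  refine ⟨max C 0, le_max_right _ _, fun t => ?_⟩
  rcases le_or_gt t 0 with h0 | h0
  · rw [deriv_smoothTransition_of_nonpos h0, abs_zero]
    exact le_max_right _ _
  rcases le_or_gt 1 t with h1 | h1
  · rw [deriv_smoothTransition_of_one_le h1, abs_zero]
    exact le_max_right _ _
  exact ((Real.norm_eq_abs _).symm.le.trans (hC t ⟨h0.le, h1.le⟩)).trans (le_max_left _ _)

/-! ## The plateau cutoff -/

/-- **The smooth plateau cutoff** `cutoff R s = smoothTransition (s + R) · smoothTransition (R - s)`:
equal to `1` for `|s| ≤ R - 1`, to `0` for `|s| ≥ R`, with values in `[0, 1]`. [folklore] -/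
def cutoff (R s : ℝ) : ℝ := Real.smoothTransition (s + R) * Real.smoothTransition (R - s)

/-- `cutoff R = 1` on the plateau `|s| ≤ R - 1`. [folklore] -/
theorem cutoff_eq_one {R s : ℝ} (h : |s| ≤ R - 1) : cutoff R s = 1 := by
  rw [abs_le] at h
  rw [cutoff, Real.smoothTransition.one_of_one_le (by linarith),
    Real.smoothTransition.one_of_one_le (by linarith), mul_one]

/-- `cutoff R = 0` off `(-R, R)`. [folklore] -/
theorem cutoff_eq_zero {R s : ℝ} (h : R ≤ |s|) : cutoff R s = 0 := by
  rcases le_abs'.1 h with h | h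
  · rw [cutoff, Real.smoothTransition.zero_of_nonpos (show s + R ≤ 0 by linarith), zero_mul]
  · rw [cutoff, Real.smoothTransition.zero_of_nonpos (show R - s ≤ 0 by linarith), mul_zero]

/-- `0 ≤ cutoff R s`. [folklore] -/
theorem cutoff_nonneg (R s : ℝ) : 0 ≤ cutoff R s :=
  mul_nonneg (Real.smoothTransition.nonneg _) (Real.smoothTransition.nonneg _)

/-- `cutoff R s ≤ 1`. [folklore] -/
theorem cutoff_le_one (R s : ℝ) : cutoff R s ≤ 1 :=
  mul_le_one₀ (Real.smoothTransition.le_one _) (Real.smoothTransition.nonneg _)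
    (Real.smoothTransition.le_one _)

/-- `|cutoff R s| ≤ 1`. [folklore] -/
theorem abs_cutoff_le_one (R s : ℝ) : |cutoff R s| ≤ 1 := by
  rw [abs_of_nonneg (cutoff_nonneg R s)]
  exact cutoff_le_one R s

/-- `cutoff R` is smooth. [folklore] -/
theorem contDiff_cutoff (R : ℝ) {n : ℕ∞} : ContDiff ℝ n (cutoff R) := by
  unfold cutoff
  exact ((Real.smoothTransition.contDiff (n := n)).comp (contDiff_id.add contDiff_const)).mul
    ((Real.smoothTransition.contDiff (n := n)).comp (contDiff_const.sub contDiff_id))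

/-- The derivative of the cutoff:
`(cutoff R)' s = sT'(s + R) sT(R - s) - sT(s + R) sT'(R - s)`. [folklore] -/
theorem hasDerivAt_cutoff (R s : ℝ) : HasDerivAt (cutoff R)
    (deriv Real.smoothTransition (s + R) * Real.smoothTransition (R - s) -
      Real.smoothTransition (s + R) * deriv Real.smoothTransition (R - s)) s := by
  have h1 : HasDerivAt (fun s => Real.smoothTransition (s + R))
      (deriv Real.smoothTransition (s + R)) s :=
    (differentiable_smoothTransition (s + R)).hasDerivAt.comp_add_const s R
  have h2 : HasDerivAt (fun s => Real.smoothTransition (R - s))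
      (-deriv Real.smoothTransition (R - s)) s :=
    (differentiable_smoothTransition (R - s)).hasDerivAt.comp_const_sub R s
  exact (h1.mul h2).congr_deriv (by ring)

/-- The closed form of `deriv (cutoff R)`. [folklore] -/
theorem deriv_cutoff (R s : ℝ) : deriv (cutoff R) s =
    deriv Real.smoothTransition (s + R) * Real.smoothTransition (R - s) -
      Real.smoothTransition (s + R) * deriv Real.smoothTransition (R - s) :=
  (hasDerivAt_cutoff R s).deriv

/-- **Uniform derivative bound**: `|(cutoff R)' s| ≤ 2 D` with `D` a bound for `|smoothTransition'|`,
independently of `R`. [folklore] -/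
theorem exists_bound_deriv_cutoff : ∃ D : ℝ, 0 ≤ D ∧ ∀ R s, |deriv (cutoff R) s| ≤ D := by
  obtain ⟨D, hD0, hD⟩ := exists_bound_deriv_smoothTransition
  refine ⟨2 * D, by positivity, fun R s => ?_⟩
  rw [deriv_cutoff]
  have h1 : |deriv Real.smoothTransition (s + R) * Real.smoothTransition (R - s)| ≤ D := by
    rw [abs_mul, abs_of_nonneg (Real.smoothTransition.nonneg _)]
    exact (mul_le_of_le_one_right (abs_nonneg _) (Real.smoothTransition.le_one _)).trans (hD _)
  have h2 : |Real.smoothTransition (s + R) * deriv Real.smoothTransition (R - s)| ≤ D := by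
    rw [abs_mul, abs_of_nonneg (Real.smoothTransition.nonneg _)]
    exact (mul_le_of_le_one_left (abs_nonneg _) (Real.smoothTransition.le_one _)).trans (hD _)
  calc _ ≤ |deriv Real.smoothTransition (s + R) * Real.smoothTransition (R - s)| +
        |Real.smoothTransition (s + R) * deriv Real.smoothTransition (R - s)| := abs_sub _ _
    _ ≤ D + D := add_le_add h1 h2
    _ = 2 * D := by ring

/-- Off `(-R, R)` the derivative of the cutoff vanishes too. [folklore] -/
theorem deriv_cutoff_eq_zero_of_le {R s : ℝ} (h : R ≤ |s|) : deriv (cutoff R) s = 0 := by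
  rw [deriv_cutoff]
  rcases le_abs'.1 h with h | h
  · rw [Real.smoothTransition.zero_of_nonpos (show s + R ≤ 0 by linarith),
      deriv_smoothTransition_of_nonpos (show s + R ≤ 0 by linarith)]
    ring
  · rw [Real.smoothTransition.zero_of_nonpos (show R - s ≤ 0 by linarith),
      deriv_smoothTransition_of_nonpos (show R - s ≤ 0 by linarith)]
    ring

/-- On the open plateau `|s| < R - 1` the derivative of the cutoff vanishes. [folklore] -/
theorem deriv_cutoff_eq_zero_of_lt {R s : ℝ} (h : |s| < R - 1) : deriv (cutoff R) s = 0 := by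
  have heq : cutoff R =ᶠ[𝓝 s] fun _ => (1 : ℝ) := by
    have ho : IsOpen {t : ℝ | |t| < R - 1} := isOpen_lt continuous_abs continuous_const
    filter_upwards [ho.mem_nhds h] with t ht
    exact cutoff_eq_one (le_of_lt ht)
  rw [heq.deriv_eq, deriv_const]

/-! ## Truncation of Schrödinger-type quadratic forms -/

/-- The truncated test function `φ_R = cutoff R · ψ`. [folklore] -/
def truncFun (ψ : ℝ → ℝ) (R s : ℝ) : ℝ := cutoff R s * ψ s

/-- Its derivative (for differentiable `ψ`): `φ_R' = (cutoff R)' ψ + cutoff R · ψ'`. [folklore] -/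
def truncDeriv (ψ : ℝ → ℝ) (R s : ℝ) : ℝ := deriv (cutoff R) s * ψ s + cutoff R s * deriv ψ s

/-- The truncated form density `φ_R'² + (W - E') φ_R²`. [folklore] -/
def truncForm (W : ℝ → ℝ) (E' : ℝ) (ψ : ℝ → ℝ) (R s : ℝ) : ℝ :=
  truncDeriv ψ R s ^ 2 + (W s - E') * truncFun ψ R s ^ 2

/-- `φ_R` has derivative `truncDeriv ψ R` (for differentiable `ψ`). [folklore] -/
theorem hasDerivAt_truncFun {ψ : ℝ → ℝ} (hψ : Differentiable ℝ ψ) (R s : ℝ) :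
    HasDerivAt (truncFun ψ R) (truncDeriv ψ R s) s := by
  unfold truncFun truncDeriv
  exact ((hasDerivAt_cutoff R s).mul (hψ s).hasDerivAt).congr_deriv (by rw [deriv_cutoff])

/-- `φ_R` is `C¹` when `ψ` is: its derivative `truncDeriv ψ R` is continuous. [folklore] -/
theorem continuous_truncDeriv {ψ : ℝ → ℝ} (hψ : ContDiff ℝ 1 ψ) (R : ℝ) :
    Continuous (truncDeriv ψ R) := by
  unfold truncDeriv
  have h1 : Continuous (deriv (cutoff R)) := (contDiff_cutoff R (n := 1)).continuous_deriv le_rfl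
  have h2 : Continuous (deriv ψ) := hψ.continuous_deriv le_rfl
  exact (h1.mul hψ.continuous).add ((contDiff_cutoff R (n := 0)).continuous.mul h2)

/-- `φ_R` vanishes off `(-R, R)`; in particular `φ_R (-R) = φ_R R = 0`. [folklore] -/
theorem truncFun_eq_zero {ψ : ℝ → ℝ} {R s : ℝ} (h : R ≤ |s|) : truncFun ψ R s = 0 := by
  rw [truncFun, cutoff_eq_zero h, zero_mul]

/-- `φ_R'` vanishes off `(-R, R)`. [folklore] -/
theorem truncDeriv_eq_zero {ψ : ℝ → ℝ} {R s : ℝ} (h : R ≤ |s|) : truncDeriv ψ R s = 0 := by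
  rw [truncDeriv, cutoff_eq_zero h, deriv_cutoff_eq_zero_of_le h]
  ring

/-- The truncated density vanishes off `(-R, R)`. [folklore] -/
theorem truncForm_eq_zero {W : ℝ → ℝ} {E' : ℝ} {ψ : ℝ → ℝ} {R s : ℝ} (h : R ≤ |s|) :
    truncForm W E' ψ R s = 0 := by
  rw [truncForm, truncFun_eq_zero h, truncDeriv_eq_zero h]
  ring

/-- On the plateau `|s| < R - 1` the truncated density is the original one. [folklore] -/
theorem truncForm_eq_of_lt {W : ℝ → ℝ} {E' : ℝ} {ψ : ℝ → ℝ} {R s : ℝ} (h : |s| < R - 1) :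
    truncForm W E' ψ R s = deriv ψ s ^ 2 + (W s - E') * ψ s ^ 2 := by
  rw [truncForm, truncFun, truncDeriv, cutoff_eq_one h.le, deriv_cutoff_eq_zero_of_lt h]
  ring

/-- **Domination**: with `D` a bound for `|(cutoff R)'|`,
`|truncForm R s| ≤ |ψ'² + (W - E') ψ²| + (D² + D) ψ² + D ψ'²` for all `R`. [folklore] -/
theorem abs_truncForm_le {W : ℝ → ℝ} {E' : ℝ} {ψ : ℝ → ℝ} {D : ℝ} (hD0 : 0 ≤ D)
    (hD : ∀ R s, |deriv (cutoff R) s| ≤ D) (R s : ℝ) :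
    |truncForm W E' ψ R s| ≤ |deriv ψ s ^ 2 + (W s - E') * ψ s ^ 2| +
      ((D ^ 2 + D) * ψ s ^ 2 + D * deriv ψ s ^ 2) := by
  have hχ0 := cutoff_nonneg R s
  have hχ1 := cutoff_le_one R s
  have hd := hD R s
  set χ := cutoff R s with hχ
  set χ' := deriv (cutoff R) s with hχ'
  -- `truncForm = χ² g + (χ'² ψ² + 2 χ χ' ψ ψ')`
  have hsplit : truncForm W E' ψ R s = χ ^ 2 * (deriv ψ s ^ 2 + (W s - E') * ψ s ^ 2) +
      (χ' ^ 2 * ψ s ^ 2 + 2 * χ * χ' * ψ s * deriv ψ s) := by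
    simp only [truncForm, truncFun, truncDeriv, ← hχ, ← hχ']
    ring
  rw [hsplit]
  have hχsq : χ ^ 2 ≤ 1 := by nlinarith
  have h1 : |χ ^ 2 * (deriv ψ s ^ 2 + (W s - E') * ψ s ^ 2)| ≤
      |deriv ψ s ^ 2 + (W s - E') * ψ s ^ 2| := by
    rw [abs_mul, abs_of_nonneg (sq_nonneg χ)]
    exact mul_le_of_le_one_left (abs_nonneg _) hχsq
  have habsχ' : |χ'| ≤ D := hd
  have h2 : |χ' ^ 2 * ψ s ^ 2 + 2 * χ * χ' * ψ s * deriv ψ s| ≤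
      (D ^ 2 + D) * ψ s ^ 2 + D * deriv ψ s ^ 2 := by
    have hχ'sq : χ' ^ 2 ≤ D ^ 2 := by
      rw [← sq_abs χ']; exact pow_le_pow_left₀ (abs_nonneg _) habsχ' 2
    have hA : |χ' ^ 2 * ψ s ^ 2| ≤ D ^ 2 * ψ s ^ 2 := by
      rw [abs_mul, abs_of_nonneg (sq_nonneg χ'), abs_of_nonneg (sq_nonneg (ψ s))]
      exact mul_le_mul_of_nonneg_right hχ'sq (sq_nonneg _)
    have hB : |2 * χ * χ' * ψ s * deriv ψ s| ≤ D * (ψ s ^ 2 + deriv ψ s ^ 2) := by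
      have hprod : |ψ s * deriv ψ s| ≤ (ψ s ^ 2 + deriv ψ s ^ 2) / 2 := by
        rw [abs_le]
        constructor <;> nlinarith [sq_nonneg (ψ s + deriv ψ s), sq_nonneg (ψ s - deriv ψ s)]
      have hχabs : |χ| ≤ 1 := by rw [abs_of_nonneg hχ0]; exact hχ1
      calc |2 * χ * χ' * ψ s * deriv ψ s| = 2 * |χ| * |χ'| * |ψ s * deriv ψ s| := by
            simp only [abs_mul, abs_two]; ring
        _ ≤ 2 * 1 * D * ((ψ s ^ 2 + deriv ψ s ^ 2) / 2) := by
            refine mul_le_mul (mul_le_mul (mul_le_mul_of_nonneg_left hχabs zero_le_two) habsχ'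
              (abs_nonneg _) (by positivity)) hprod (abs_nonneg _) (by positivity)
        _ = D * (ψ s ^ 2 + deriv ψ s ^ 2) := by ring
    calc _ ≤ |χ' ^ 2 * ψ s ^ 2| + |2 * χ * χ' * ψ s * deriv ψ s| := abs_add_le _ _
      _ ≤ D ^ 2 * ψ s ^ 2 + D * (ψ s ^ 2 + deriv ψ s ^ 2) := add_le_add hA hB
      _ = (D ^ 2 + D) * ψ s ^ 2 + D * deriv ψ s ^ 2 := by ring
  exact (abs_add_le _ _).trans (add_le_add h1 h2)

/-- **Truncation lemma.** Let `W` be continuous with `|W| ≤ B`, `ψ` of class `C¹` with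
`ψ², ψ'²` integrable on `ℝ`, and `∫ (ψ'² + W ψ²) < E' ∫ ψ²`. Then for all sufficiently large `R` the
compactly supported truncation `φ_R = cutoff R · ψ` satisfies
`∫_{-R}^{R} (φ_R'² + (W - E') φ_R²) < 0` (dominated convergence: the truncated densities converge
pointwise to `ψ'² + (W - E')ψ²`, whose integral is negative, and are dominated by a fixed
integrable function). [folklore] -/
theorem exists_truncForm_integral_neg {W : ℝ → ℝ} (hW : Continuous W) {B : ℝ} (hB : ∀ s, |W s| ≤ B)
    {E' : ℝ} {ψ : ℝ → ℝ} (hψ : ContDiff ℝ 1 ψ) (hL2 : Integrable (fun s => ψ s ^ 2))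
    (hL2' : Integrable (fun s => deriv ψ s ^ 2))
    (hlt : ∫ s, (deriv ψ s ^ 2 + W s * ψ s ^ 2) < E' * ∫ s, ψ s ^ 2) :
    ∃ R₀ : ℝ, 1 ≤ R₀ ∧ ∀ R, R₀ ≤ R → ∫ s in (-R)..R, truncForm W E' ψ R s < 0 := by
  have hψc : Continuous ψ := hψ.continuous
  have hψ'c : Continuous (deriv ψ) := hψ.continuous_deriv le_rfl
  -- the limit density `g = ψ'² + (W - E') ψ²` is integrable with negative integral
  set g : ℝ → ℝ := fun s => deriv ψ s ^ 2 + (W s - E') * ψ s ^ 2 with hg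
  have hgc : Continuous g := by
    simp only [hg]
    fun_prop
  have hWψ : Integrable (fun s => W s * ψ s ^ 2) := by
    refine Integrable.mono' (hL2.const_mul |B|) (by fun_prop) (ae_of_all _ fun s => ?_)
    rw [Real.norm_eq_abs, abs_mul, abs_of_nonneg (sq_nonneg (ψ s))]
    exact mul_le_mul_of_nonneg_right ((hB s).trans (le_abs_self B)) (sq_nonneg _)
  have hI : Integrable (fun s => deriv ψ s ^ 2 + W s * ψ s ^ 2) := hL2'.add hWψ
  have hI' : Integrable (fun s => E' * ψ s ^ 2) := hL2.const_mul E'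
  have hgi : Integrable g := by
    have : g = fun s => (deriv ψ s ^ 2 + W s * ψ s ^ 2) - E' * ψ s ^ 2 := by
      funext s; simp only [hg]; ring
    rw [this]
    exact hI.sub hI'
  have hgneg : ∫ s, g s < 0 := by
    have : ∫ s, g s = (∫ s, (deriv ψ s ^ 2 + W s * ψ s ^ 2)) - E' * ∫ s, ψ s ^ 2 := by
      rw [← integral_const_mul, ← integral_sub hI hI']
      refine integral_congr_ae (ae_of_all _ fun s => ?_)
      simp only [hg]
      ring
    rw [this]
    linarith
  -- domination
  obtain ⟨D, hD0, hD⟩ := exists_bound_deriv_cutoff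
  set bound : ℝ → ℝ := fun s => |g s| + ((D ^ 2 + D) * ψ s ^ 2 + D * deriv ψ s ^ 2) with hbound
  have hbi : Integrable bound :=
    hgi.abs.add ((hL2.const_mul _).add (hL2'.const_mul _))
  have hFm : ∀ R, AEStronglyMeasurable (truncForm W E' ψ R) volume := fun R => by
    refine Continuous.aestronglyMeasurable ?_
    unfold truncForm truncFun
    have h1 := continuous_truncDeriv hψ R
    have h2 : Continuous (cutoff R) := (contDiff_cutoff R (n := 0)).continuous
    fun_prop
  have hdom : ∀ R, ∀ᵐ s ∂volume, ‖truncForm W E' ψ R s‖ ≤ bound s := fun R =>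
    ae_of_all _ fun s => by
      rw [Real.norm_eq_abs]
      exact abs_truncForm_le hD0 hD R s
  -- pointwise convergence (eventually constant)
  have hpt : ∀ᵐ s ∂volume, Tendsto (fun R => truncForm W E' ψ R s) atTop (𝓝 (g s)) :=
    ae_of_all _ fun s => by
      refine (tendsto_const_nhds (x := g s)).congr' ?_
      filter_upwards [eventually_ge_atTop (|s| + 2)] with R hR
      rw [truncForm_eq_of_lt (by linarith)]
  have hlim : Tendsto (fun R => ∫ s, truncForm W E' ψ R s) atTop (𝓝 (∫ s, g s)) :=
    tendsto_integral_filter_of_dominated_convergence bound (Eventually.of_forall hFm)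
      (Eventually.of_forall hdom) hbi hpt
  -- conclusion
  obtain ⟨R₁, hR₁⟩ := eventually_atTop.1 (hlim.eventually_lt_const hgneg)
  refine ⟨max R₁ 1, le_max_right _ _, fun R hR => ?_⟩
  have hRpos : 0 < R := lt_of_lt_of_le zero_lt_one ((le_max_right _ _).trans hR)
  rw [intervalIntegral.integral_eq_integral_of_support_subset]
  · exact hR₁ R ((le_max_left _ _).trans hR)
  · intro s hs
    rw [Function.mem_support] at hs
    by_contra hs'
    refine hs (truncForm_eq_zero ?_)
    rw [mem_Ioc, not_and_or, not_lt, not_le] at hs'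
    rcases hs' with h | h
    · rw [le_abs']
      exact Or.inl h
    · exact h.le.trans (le_abs_self s)

end Literature.Analysis.Calculus
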